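import Summits.QuantumAdvantage.AdviceFreeQNC0.TwoBlindSpotsPlusFibre
import Summits.QuantumAdvantage.AdviceFreeQNC0.LowDegreeGapStrategies
import HarnessLib

/-!
# Cell qa-qnc0 (rung F-Q1, route RingFrame, crux α `RingToElim`): TWO BLIND SPOTS⁺ — no global
# degree hypothesis (planner qa-qnc0-p1's T8⁺, Sketch11 §23.1⁺ `TwoBlindSpotsPlus`, VERBATIM)

**T8⁺** (`twoBlindSpotsPlus : TwoBlindSpotsPlus`).  There are `θ < 1`, `c₁ > 0`, `M₀` such that:
for a block `[p, p+M)` of `M ≥ M₀` input bits, an ADJACENT pair of bits `{t, t+1}` outside it,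
`D ≤ c₁√M`, every charge and every walk strategy `y` on `n` bits such that
* every cut strictly inside the block is BLIND to the pair (any complexity otherwise),
* the cut `t + 1` (between the two bits) has degree `≤ D` TOWARDS the block,
* every other cut is blind to the pair OR has degree `≤ D` towards the block,
the ring game in walk coordinates is won on at most `θ·2ⁿ` inputs (`θ = 1 − η₀/4`).  Degree is
only ever needed towards the block; blindness only towards the pair.  T8 (`ringWinU_twoBlind_le`,
all selectors of degree `≤ D`) is the special case where every cut is light.

Proof (fibre lemmas in `TwoBlindSpotsPlusFibre.lean`).  Fix the outside blocks `(a, b)`; split the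
cuts into the light non-interior ones `Lt` and the rest (all blind to the pair, none equal to
`t + 1`).  On the fibre, `WIN(z) = E(z) ⊕ B_0(z)` with `¬E` an elimination fail pattern of degree
`≤ D` (`isElimFail_not_lightPart`) and `B_σ` the `σ`-shifted blind part; flipping `u_t`, `u_{t+1}`
or both keeps the blind selectors and replaces `B_0` by `B_{ε_t}`, `B_{ε_{t+1}}`,
`B_{ε_t + ε_{t+1}}` (`blindPart_flip`), `ε ∈ {1, 2}`, so the four fibres meet all three shifts;
each loses `≥ distFail_D(B_σ)` and `Σ_σ distFail_D(B_σ) ≥ distFail_D(0) ≥ η₀·2^M`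
(`blindPart_xor3`, `potential_cost`, `le_distFail_zero_of`); the flips are bijections
(`card_filter_flip`): `4·#LOSS ≥ 2^{n−M}·η₀·2^M`.

The cell's theorem (planner qa-qnc0-p1 gen 11, statement; prover qn-prover-3 gen 4, proof),
2026-08-27; not in print.  WHAT THIS IS NOT: nothing on totally sighted strategies (α proper);
`η₀` is tiny; no separation.

## References

* S. Srinivasan, *A robust version of Hegedűs's lemma, with applications*, TheoretiCS 2 (2023),
  Lemma 3.1 [Srinivasan2023] (through `lowDegAvoidMod3Sparse`).
-/

noncomputable section

namespace Summit.QuantumAdvantage.AdviceFreeQNC0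

open Finset
open Literature.Computability.MetaComplexity Literature.Computability.MetaComplexity.Smolensky

/-! ### Sketch11 §23.1⁺, verbatim -/

/-- **T8⁺ (no global degree hypothesis)** (planner qa-qnc0-p1, `Sketch11` §23.1⁺, verbatim).
Block `z = [p, p+M)`, an adjacent pair `{t, t+1}` outside it.  Per cut: strictly inside the block
⇒ blind to the pair (any complexity); the cut `t+1` between the pair ⇒ degree `≤ D` towards the
block; every other cut ⇒ blind to the pair OR degree `≤ D` towards the block.  Then
`#WIN ≤ θ·2ⁿ`, `θ = 1 − η₀/4` from `elimHard` at `(M, D)`. -/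
def TwoBlindSpotsPlus : Prop :=
  ∃ θ : ℝ, θ < 1 ∧ ∃ c₁ : ℝ, 0 < c₁ ∧ ∃ M₀ : ℕ, ∀ n p M t D : ℕ, M₀ ≤ M → p + M ≤ n →
    (D : ℝ) ≤ c₁ * Real.sqrt M → t + 2 ≤ n → (t + 2 ≤ p ∨ p + M ≤ t) →
    ∀ (c : ℕ) (y : Fin (n + 1) → (Fin n → Bool) → Bool),
      (∀ g : Fin (n + 1), p < g.val → g.val < p + M → BlindPair t (y g)) →
      (∀ g : Fin (n + 1), g.val = t + 1 → HasDegTowards p M D (y g)) →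
      (∀ g : Fin (n + 1), (g.val ≤ p ∨ p + M ≤ g.val) → g.val ≠ t + 1 →
        BlindPair t (y g) ∨ HasDegTowards p M D (y g)) →
      ((univ.filter fun u : Fin n → Bool => ringWinU c y u = true).card : ℝ) ≤ θ * (2 : ℝ) ^ n

/-! ### Two arithmetic tools -/

/-- A split `W = E ⊕ B` with `¬E` a fail pattern loses at least `distFail_D(B)`. -/
private theorem distFail_le_loss_of_split {M D : ℕ} {E B : (Fin M → Bool) → Bool}
    (hE : IsElimFail D (fun z => !(E z))) (W : (Fin M → Bool) → Bool)
    (hW : ∀ z, W z = xor (E z) (B z)) :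
    distFail D B ≤ (univ.filter fun z : Fin M → Bool => W z = false).card := by
  refine le_trans (distFail_le B hE) (le_of_eq (congrArg Finset.card (Finset.filter_congr ?_)))
  intro z _
  dsimp only
  rw [hW z]
  cases E z <;> cases B z <;> decide

/-- Four charges `0, s, t, s + t` with `s, t ≢ 0 (mod 3)` meet every residue: the four losses
dominate `f 0 + f 1 + f 2`. -/
private theorem cover_sum (f : ℕ → ℕ) (dF L₀ L₁ L₂ L₃ s t : ℕ) (hs : s % 3 ≠ 0) (ht : t % 3 ≠ 0)
    (hpc : dF ≤ f 0 + f 1 + f 2) (h₀ : f 0 ≤ L₀) (h₁ : f (s % 3) ≤ L₁) (h₂ : f (t % 3) ≤ L₂)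
    (h₃ : f ((s + t) % 3) ≤ L₃) : dF ≤ L₀ + L₁ + L₂ + L₃ := by
  have hs' : s % 3 = 1 ∨ s % 3 = 2 := by omega
  have ht' : t % 3 = 1 ∨ t % 3 = 2 := by omega
  rcases hs' with hs1 | hs2
  · rw [hs1] at h₁
    rcases ht' with ht1 | ht2
    · rw [ht1] at h₂; rw [show (s + t) % 3 = 2 by omega] at h₃; omega
    · rw [ht2] at h₂; rw [show (s + t) % 3 = 0 by omega] at h₃; omega
  · rw [hs2] at h₁
    rcases ht' with ht1 | ht2
    · rw [ht1] at h₂; rw [show (s + t) % 3 = 0 by omega] at h₃; omega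
    · rw [ht2] at h₂; rw [show (s + t) % 3 = 1 by omega] at h₃; omega

/-! ### The theorem -/

/-- **`TwoBlindSpotsPlus` holds (T8⁺).** [cite: Srinivasan2023, Lemma 3.1] -/
theorem twoBlindSpotsPlus : TwoBlindSpotsPlus := by
  classical
  obtain ⟨η₀, hη₀, c₀, hc₀, ℓ₀, H⟩ := elimSqrtDec_of_lowDegAvoidMod3Sparse lowDegAvoidMod3Sparse
  refine ⟨1 - η₀ / 4, by linarith, c₀, hc₀, ℓ₀, ?_⟩
  intro n p M t D hM hpM hD ht2 hside c y h1 h2 h3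
  obtain ⟨q, rfl⟩ : ∃ q, n = p + M + q := ⟨n - (p + M), by omega⟩
  -- the two positions of the pair
  set i : Fin (p + M + q) := ⟨t, by omega⟩ with hi
  set j : Fin (p + M + q) := ⟨t + 1, by omega⟩ with hj
  have hij : i ≠ j := by
    intro h; have h' := congrArg Fin.val h; simp only [hi, hj] at h'; omega
  have hiv : i.val = t := rfl
  have hjv : j.val = t + 1 := rfl
  have hiout : ¬ (p ≤ i.val ∧ i.val < p + M) := by rw [hiv]; omega
  have hjout : ¬ (p ≤ j.val ∧ j.val < p + M) := by rw [hjv]; omega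
  have hiout' : i.val < p ∨ p + M ≤ i.val := by rw [hiv]; omega
  have hjout' : j.val < p ∨ p + M ≤ j.val := by rw [hjv]; omega
  -- elimination hardness on the block
  have hdF : η₀ * (2 : ℝ) ^ M ≤ (distFail D (fun _ : Fin M → Bool => false) : ℝ) :=
    le_distFail_zero_of fun a b ha hb dec => H M hM D hD a b ha hb dec
  -- the light cuts and the blind cuts
  set Lt : Finset (Fin (p + M + q + 1)) := univ.filter fun g =>
    (g.val ≤ p ∨ p + M ≤ g.val) ∧ HasDegTowards p M D (y g) with hLt
  have hLt' : ∀ g ∈ Lt, (g.val ≤ p ∨ p + M ≤ g.val) ∧ HasDegTowards p M D (y g) :=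
    fun g hg => (Finset.mem_filter.1 hg).2
  have hBl' : ∀ g ∈ (univ : Finset (Fin (p + M + q + 1))) \ Lt,
      BlindPair t (y g) ∧ (g.val ≤ t ∨ t + 2 ≤ g.val) := by
    intro g hg
    rw [Finset.mem_sdiff] at hg
    have hnot : ¬ ((g.val ≤ p ∨ p + M ≤ g.val) ∧ HasDegTowards p M D (y g)) :=
      fun h => hg.2 (Finset.mem_filter.2 ⟨Finset.mem_univ _, h⟩)
    by_cases hint : p < g.val ∧ g.val < p + M
    · exact ⟨h1 g hint.1 hint.2, by rcases hside with hs | hs <;> omega⟩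
    · have hpos : g.val ≤ p ∨ p + M ≤ g.val := by omega
      have hne : g.val ≠ t + 1 := fun he => hnot ⟨hpos, h2 g he⟩
      rcases h3 g hpos hne with hb | hl
      · exact ⟨hb, by omega⟩
      · exact absurd ⟨hpos, hl⟩ hnot
  -- loss counts after a map `ψ`, fibrewise
  set T : ((Fin (p + M + q) → Bool) → (Fin (p + M + q) → Bool)) → (Fin p → Bool) → (Fin q → Bool) → ℕ :=
    fun ψ a b => (univ.filter fun z : Fin M → Bool => ringWinU c y (ψ (glue3 a z b)) = false).card
    with hT
  set φi : (Fin (p + M + q) → Bool) → (Fin (p + M + q) → Bool) :=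
    fun u => Function.update u i (!u i) with hφi
  set φj : (Fin (p + M + q) → Bool) → (Fin (p + M + q) → Bool) :=
    fun u => Function.update u j (!u j) with hφj
  -- the four fibres over `(a, b)` lose at least `distFail 0`
  have hfour : ∀ (a : Fin p → Bool) (b : Fin q → Bool),
      distFail D (fun _ : Fin M → Bool => false) ≤
        T id a b + T φi a b + T φj a b + T (φj ∘ φi) a b := by
    intro a b
    obtain ⟨a₁, b₁, h₁, -⟩ := exists_flip_glue3 c i hiout a b
    obtain ⟨a₂, b₂, h₂, -⟩ := exists_flip_glue3 c j hjout a b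
    obtain ⟨a₃, b₃, h₃, -⟩ := exists_flip_glue3 c j hjout a₁ b₁
    set z₀ : Fin M → Bool := fun _ => false with hz₀
    -- the shifted blind parts on the base fibre
    set B : ℕ → (Fin M → Bool) → Bool := fun σ z =>
      decide ((((univ : Finset (Fin (p + M + q + 1))) \ Lt).filter fun g =>
        y g (glue3 a z b) = true ∧ (c + g.val + walkExp (glue3 a z b) g.val
          + (if g.val ≤ t then 1 else 2) * σ) % 3 ≠ 0).card % 2 = 1) with hB
    have hBeven : ∀ z, xor (xor (B 0 z) (B 1 z)) (B 2 z) = false := fun z =>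
      blindPart_xor3 c y _ t (glue3 a z b)
    have hpc : distFail D (fun _ : Fin M → Bool => false) ≤
        distFail D (B 0) + distFail D (B 1) + distFail D (B 2) :=
      potential_cost D (B 0) (B 1) (B 2) hBeven
    have hBmod : ∀ σ, B σ = B (σ % 3) := by
      intro σ; funext z
      exact congrArg (fun S : Finset (Fin (p + M + q + 1)) => decide (S.card % 2 = 1))
        (blindPart_mod c y _ t (glue3 a z b) σ)
    -- inserting the shift `σ = 0`
    have hzero : ∀ u : Fin (p + M + q) → Bool,
        (((univ : Finset (Fin (p + M + q + 1))) \ Lt).filter fun g =>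
          y g u = true ∧ (c + g.val + walkExp u g.val) % 3 ≠ 0) =
        ((univ : Finset (Fin (p + M + q + 1))) \ Lt).filter fun g =>
          y g u = true ∧ (c + g.val + walkExp u g.val + (if g.val ≤ t then 1 else 2) * 0) % 3 ≠ 0 :=
      fun u => Finset.filter_congr fun g _ => by simp only [Nat.mul_zero, Nat.add_zero]
    -- the pair bits on the base fibre do not depend on `z`
    have hεi : ∀ z, (if glue3 a z b i = true then 2 else 1) =
        (if glue3 a z₀ b i = true then 2 else 1) := fun z => by
      rw [glue3_eq_outside a z z₀ b i hiout']
    have hεj : ∀ z, (if glue3 a z b j = true then 2 else 1) =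
        (if glue3 a z₀ b j = true then 2 else 1) := fun z => by
      rw [glue3_eq_outside a z z₀ b j hjout']
    set s : ℕ := if glue3 a z₀ b i = true then 2 else 1 with hs
    set t' : ℕ := if glue3 a z₀ b j = true then 2 else 1 with ht'
    have hs0 : s % 3 ≠ 0 := by rw [hs]; split_ifs <;> decide
    have ht0 : t' % 3 ≠ 0 := by rw [ht']; split_ifs <;> decide
    -- fibre `id`
    have L0 : distFail D (B 0) ≤ T id a b := by
      refine distFail_le_loss_of_split (isElimFail_not_lightPart c y Lt hLt' a b)
        (fun z => ringWinU c y (id (glue3 a z b))) fun z => ?_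
      show ringWinU c y (glue3 a z b) = _
      rw [ringWinU_eq_xor_parts Lt c y (glue3 a z b), hzero]
    -- fibre `φi`
    have L1 : distFail D (B (0 + s)) ≤ T φi a b := by
      refine distFail_le_loss_of_split (isElimFail_not_lightPart c y Lt hLt' a₁ b₁)
        (fun z => ringWinU c y (φi (glue3 a z b))) fun z => ?_
      show ringWinU c y (Function.update (glue3 a z b) i (!(glue3 a z b i))) = _
      rw [h₁ z, ringWinU_eq_xor_parts Lt c y (glue3 a₁ z b₁), hzero, ← h₁ z,
        blindPart_flip c y _ t i (Or.inl hiv) hBl' (glue3 a z b) 0, hεi z]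
    -- fibre `φj`
    have L2 : distFail D (B (0 + t')) ≤ T φj a b := by
      refine distFail_le_loss_of_split (isElimFail_not_lightPart c y Lt hLt' a₂ b₂)
        (fun z => ringWinU c y (φj (glue3 a z b))) fun z => ?_
      show ringWinU c y (Function.update (glue3 a z b) j (!(glue3 a z b j))) = _
      rw [h₂ z, ringWinU_eq_xor_parts Lt c y (glue3 a₂ z b₂), hzero, ← h₂ z,
        blindPart_flip c y _ t j (Or.inr hjv) hBl' (glue3 a z b) 0, hεj z]
    -- fibre `φj ∘ φi`
    have L3 : distFail D (B (0 + t' + s)) ≤ T (φj ∘ φi) a b := by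
      refine distFail_le_loss_of_split (isElimFail_not_lightPart c y Lt hLt' a₃ b₃)
        (fun z => ringWinU c y ((φj ∘ φi) (glue3 a z b))) fun z => ?_
      show ringWinU c y (Function.update (Function.update (glue3 a z b) i (!(glue3 a z b i))) j
        (!(Function.update (glue3 a z b) i (!(glue3 a z b i)) j))) = _
      have hbit : Function.update (glue3 a z b) i (!(glue3 a z b i)) j = glue3 a z₀ b j := by
        rw [Function.update_of_ne hij.symm, glue3_eq_outside a z z₀ b j hjout']
      rw [h₁ z, h₃ z, ringWinU_eq_xor_parts Lt c y (glue3 a₃ z b₃), hzero, ← h₃ z,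
        blindPart_flip c y _ t j (Or.inr hjv) hBl' (glue3 a₁ z b₁) 0, ← h₁ z,
        blindPart_flip c y _ t i (Or.inl hiv) hBl' (glue3 a z b) _, hbit, hεi z]
    -- cover
    rw [hBmod (0 + s)] at L1
    rw [hBmod (0 + t')] at L2
    rw [hBmod (0 + t' + s)] at L3
    rw [Nat.zero_add] at L1 L2
    rw [Nat.zero_add, Nat.add_comm] at L3
    exact cover_sum (fun r => distFail D (B r)) _ _ _ _ _ s t' hs0 ht0 hpc L0 L1 L2 L3
  -- the loss count, and its four copies
  set LOSS := (univ.filter fun u : Fin (p + M + q) → Bool => ringWinU c y u = false).card with hLOSS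
  have hcopy : ∀ ψ : (Fin (p + M + q) → Bool) → (Fin (p + M + q) → Bool),
      (univ.filter fun u : Fin (p + M + q) → Bool => ringWinU c y (ψ u) = false).card =
        ∑ a : Fin p → Bool, ∑ b : Fin q → Bool, T ψ a b := fun ψ =>
    card_filter_eq_sum_glue3 (fun u => ringWinU c y (ψ u) = false)
  have hLid : LOSS = ∑ a : Fin p → Bool, ∑ b : Fin q → Bool, T id a b := hcopy id
  have hLi : LOSS = ∑ a : Fin p → Bool, ∑ b : Fin q → Bool, T φi a b := by
    rw [← hcopy φi, hLOSS]
    exact (card_filter_flip i (fun u : Fin (p + M + q) → Bool => ringWinU c y u = false)).symm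
  have hLj : LOSS = ∑ a : Fin p → Bool, ∑ b : Fin q → Bool, T φj a b := by
    rw [← hcopy φj, hLOSS]
    exact (card_filter_flip j (fun u : Fin (p + M + q) → Bool => ringWinU c y u = false)).symm
  have hLij : LOSS = ∑ a : Fin p → Bool, ∑ b : Fin q → Bool, T (φj ∘ φi) a b := by
    rw [← hcopy (φj ∘ φi), hLOSS]
    calc (univ.filter fun u : Fin (p + M + q) → Bool => ringWinU c y u = false).card
        = (univ.filter fun u : Fin (p + M + q) → Bool => ringWinU c y (φj u) = false).card :=
          (card_filter_flip j (fun u : Fin (p + M + q) → Bool => ringWinU c y u = false)).symm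
      _ = (univ.filter fun u : Fin (p + M + q) → Bool => ringWinU c y (φj (φi u)) = false).card :=
          (card_filter_flip i (fun u : Fin (p + M + q) → Bool => ringWinU c y (φj u) = false)).symm
      _ = _ := rfl
  have h4 : (distFail D (fun _ : Fin M → Bool => false)) * 2 ^ (p + q) ≤ 4 * LOSS := by
    have hsum : 4 * LOSS = ∑ a : Fin p → Bool, ∑ b : Fin q → Bool,
        (T id a b + T φi a b + T φj a b + T (φj ∘ φi) a b) := by
      simp only [Finset.sum_add_distrib]
      omega
    rw [hsum]
    calc distFail D (fun _ : Fin M → Bool => false) * 2 ^ (p + q)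
        = ∑ _a : Fin p → Bool, ∑ _b : Fin q → Bool, distFail D (fun _ : Fin M → Bool => false) := by
          simp only [Finset.sum_const, Finset.card_univ, Fintype.card_fun, Fintype.card_bool,
            Fintype.card_fin, smul_eq_mul]
          ring
      _ ≤ _ := Finset.sum_le_sum fun a _ => Finset.sum_le_sum fun b _ => hfour a b
  -- conclude
  have htot : (univ.filter fun u : Fin (p + M + q) → Bool => ringWinU c y u = true).card + LOSS =
      2 ^ (p + M + q) := by
    have h := Finset.card_filter_add_card_filter_not
      (s := (univ : Finset (Fin (p + M + q) → Bool))) (fun u => ringWinU c y u = true)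
    have hneg : (univ.filter fun u : Fin (p + M + q) → Bool => ¬ ringWinU c y u = true) =
        univ.filter fun u : Fin (p + M + q) → Bool => ringWinU c y u = false :=
      Finset.filter_congr fun u _ => by simp
    rw [hneg, Finset.card_univ, Fintype.card_fun, Fintype.card_bool, Fintype.card_fin] at h
    rw [hLOSS]
    exact h
  have hWL : ((univ.filter fun u : Fin (p + M + q) → Bool => ringWinU c y u = true).card : ℝ) =
      (2 : ℝ) ^ (p + M + q) - (LOSS : ℝ) := by
    have h' : ((univ.filter fun u : Fin (p + M + q) → Bool => ringWinU c y u = true).card : ℝ) +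
        (LOSS : ℝ) = (2 : ℝ) ^ (p + M + q) := by exact_mod_cast htot
    linarith
  have h4R : (distFail D (fun _ : Fin M → Bool => false) : ℝ) * (2 : ℝ) ^ (p + q) ≤ 4 * (LOSS : ℝ) := by
    exact_mod_cast h4
  have hpow : (2 : ℝ) ^ (p + M + q) = (2 : ℝ) ^ M * (2 : ℝ) ^ (p + q) := by
    rw [← pow_add]; congr 1; omega
  have hpos : (0 : ℝ) ≤ (2 : ℝ) ^ (p + q) := by positivity
  have key : η₀ * (2 : ℝ) ^ (p + M + q) ≤ 4 * (LOSS : ℝ) := by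
    calc η₀ * (2 : ℝ) ^ (p + M + q) = (η₀ * (2 : ℝ) ^ M) * (2 : ℝ) ^ (p + q) := by rw [hpow]; ring
      _ ≤ (distFail D (fun _ : Fin M → Bool => false) : ℝ) * (2 : ℝ) ^ (p + q) :=
          mul_le_mul_of_nonneg_right hdF hpos
      _ ≤ 4 * (LOSS : ℝ) := h4R
  rw [hWL]
  linarith

end Summit.QuantumAdvantage.AdviceFreeQNC0
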